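import Summits.AtomisticToContinuum.Crystallization.Theorems.ChartedPlanarOrderCleanEnvironment
import Summits.AtomisticToContinuum.Crystallization.Theorems.ChartedPlanarOrderPatternFrame
import Summits.AtomisticToContinuum.Crystallization.Theorems.ChartedPlanarOrderStackedLayerGeometry

/-!
# ChartedPlanarOrder — oriented site data and class-0 exclusion (`StackedSiteData`)

decomp-a2c lens-3 (generation 23/24; N = `Theses.ChartedPlanarOrder.ChartedZeroExcessLayered`, PS column).
The two non-numeric inputs of the layering dichotomy `…StackedDichotomy`:

* §1 `SiteData` — the clauses of `…PatternFrame.exists_normal_site_data` used downstream, symmetric under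
  `n ↦ −n` (`siteData_neg`), hence ORIENTABLE along the stacking normal: `exists_oriented_siteData` (`⟪ν, A n⟫ ≥ 0`).
* §2 the HEIGHT FORMULA of a matched atom: `⟪ν, x⟫ = a′(κ c + d) + e`, `d² ≤ (1 − c²)(B − κ²)`, `|e| ≤ a′/16`.
* §3 ★★ CLASS-0 EXCLUSION `eq_of_inplane`: at an atom `q` of `Layered a b w`, an atom matched to an IN-PLANE site
  `i p₁ + j p₂` (`|i|,|j| ≤ 1`) IS the layer atom `q + i a + j b` — LOCAL SEPARATION (`…CleanEnvironment.eq_of_near`)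
  in the environment of the period atom `q + i a`, whose scale is comparable (`scale_le_of_common_length`).
-/

open MeasureTheory Set Metric
open scoped RealInnerProductSpace
open Literature.Geometry.DiscreteGeometry
open Summit.AtomisticToContinuum.Crystallization.Theorems.ChartedPlanarOrderRigidityDoor (E3)
open Summit.AtomisticToContinuum.Crystallization.Theorems.ChartedPlanarOrderDoorLayered (Layered)
open Summit.AtomisticToContinuum.Crystallization.Theorems.ChartedPlanarOrderCleanEnvironment
open Summit.AtomisticToContinuum.Crystallization.Theorems.ChartedPlanarOrderPatternFrame (exists_normal_site_data)
open Summit.AtomisticToContinuum.Crystallization.Theorems.ChartedPlanarOrderStackedLayerGeometry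

namespace Summit.AtomisticToContinuum.Crystallization.Theorems.ChartedPlanarOrderStackedSiteData

/-! ## §1 Site data, oriented along the stacking normal -/

/-- the site data of a period pair `x, y` w.r.t. a unit normal `n` and spacing `h` (clauses of
`…PatternFrame.exists_normal_site_data` used by the dichotomy). -/
def SiteData (P : Finset E3) (x y n : E3) (h : ℝ) : Prop :=
  ‖n‖ = 1 ∧ ⟪n, x⟫ = 0 ∧ ⟪n, y⟫ = 0 ∧
  (∀ z ∈ P, ⟪n, z⟫ = 0 ∨ ⟪n, z⟫ = h ∨ ⟪n, z⟫ = -h ∨ ⟪n, z⟫ = 2 * h ∨ ⟪n, z⟫ = -(2 * h)) ∧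
  (∀ z ∈ P, (‖z‖ = 1 ∨ h = Real.sqrt 6 / 3) → ⟪n, z⟫ = 0 ∨ ⟪n, z⟫ = h ∨ ⟪n, z⟫ = -h) ∧
  (∃ z ∈ P, ‖z‖ = 1 ∧ ⟪n, z⟫ = h) ∧ (∃ z ∈ P, ‖z‖ = 1 ∧ ⟪n, z⟫ = -h) ∧
  (∀ z ∈ P, ⟪n, z⟫ = 0 → ∃ i j : ℤ, (i = -1 ∨ i = 0 ∨ i = 1) ∧ (j = -1 ∨ j = 0 ∨ j = 1) ∧ z = (i : ℝ) • x + (j : ℝ) • y) ∧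
  (∀ z ∈ P, h = Real.sqrt 2 / 2 → ‖z‖ ≠ 1 → ⟪n, z⟫ = 0 ∨ ⟪n, z⟫ = 2 * h ∨ ⟪n, z⟫ = -(2 * h))

/-- site data is symmetric under `n ↦ −n`. -/
theorem siteData_neg {P : Finset E3} {x y n : E3} {h : ℝ} (hS : SiteData P x y n h) : SiteData P x y (-n) h := by
  obtain ⟨hn, hx, hy, hall, hfirst, ⟨u, hu, hu1, hut⟩, ⟨d, hd, hd1, hdt⟩, hC1, hC2⟩ := hS
  refine ⟨by rw [norm_neg, hn], by rw [inner_neg_left, hx, neg_zero], by rw [inner_neg_left, hy, neg_zero],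
    ?_, ?_, ⟨d, hd, hd1, by rw [inner_neg_left, hdt, neg_neg]⟩, ⟨u, hu, hu1, by rw [inner_neg_left, hut]⟩, ?_, ?_⟩
  · intro z hz; rw [inner_neg_left]
    rcases hall z hz with h0 | h0 | h0 | h0 | h0 <;> rw [h0]
    · left; simp
    · right; right; left; rfl
    · right; left; simp
    · right; right; right; right; rfl
    · right; right; right; left; simp
  · intro z hz h1; rw [inner_neg_left]
    rcases hfirst z hz h1 with h0 | h0 | h0 <;> rw [h0]
    · left; simp
    · right; right; rfl
    · right; left; simp
  · intro z hz h0
    rw [inner_neg_left, neg_eq_zero] at h0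
    exact hC1 z hz h0
  · intro z hz hh h1; rw [inner_neg_left]
    rcases hC2 z hz hh h1 with h0 | h0 | h0 <;> rw [h0]
    · left; simp
    · right; right; rfl
    · right; left; simp

/-- ★ ORIENTED SITE DATA: the pattern normal may be chosen with `⟪ν, A n⟫ ≥ 0`. -/
theorem exists_oriented_siteData {P : Finset E3} (hP : P = fccTwoShellPattern ∨ P = hcpTwoShellPattern)
    {x y : E3} (hx : x ∈ P) (hy : y ∈ P) (hx1 : ‖x‖ = 1) (hy1 : ‖y‖ = 1) (hnx : -x ∈ P) (hny : -y ∈ P)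
    (hxy : x ≠ y) (hxy' : x + y ≠ 0) (A : E3 →ₗᵢ[ℝ] E3) (ν : E3) :
    ∃ (n : E3) (h : ℝ),
      ((h = Real.sqrt 6 / 3 ∧ (⟪x, y⟫ = 1 / 2 ∨ ⟪x, y⟫ = -1 / 2)) ∨ (h = Real.sqrt 2 / 2 ∧ ⟪x, y⟫ = 0 ∧ P = fccTwoShellPattern)) ∧
      SiteData P x y n h ∧ 0 ≤ ⟪ν, A n⟫ := by
  obtain ⟨n, hn, hnx', hny', h, htype, hall, hfirst, hup, hdown, hC1, hC2, -⟩ :=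
    exists_normal_site_data hP hx hy hx1 hy1 hnx hny hxy hxy'
  have hS : SiteData P x y n h := ⟨hn, hnx', hny', hall, hfirst, hup, hdown, hC1, hC2⟩
  rcases le_total 0 ⟪ν, A n⟫ with h0 | h0
  · exact ⟨n, h, htype, hS, h0⟩
  · exact ⟨-n, h, htype, siteData_neg hS, by rw [map_neg, inner_neg_right]; linarith⟩

/-! ## §2 The height formula of a matched atom -/

/-- ★ HEIGHT FORMULA: an offset `x` matched to the site `z` (`‖x − a′ A z‖ ≤ a′/16`) has height
`⟪ν, x⟫ = a′(κ c + d) + e` with `κ = ⟪n, z⟫`, `c = ⟪ν, A n⟫`, `d² ≤ (1 − c²)(B − κ²)` (`‖z‖² ≤ B`), `|e| ≤ a′/16`. -/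
theorem height_formula {A : E3 →ₗᵢ[ℝ] E3} {ν n x z : E3} {a' B : ℝ} (hν : ‖ν‖ = 1) (hn : ‖n‖ = 1)
    (hz : ‖x - a' • A z‖ ≤ 1 / 16 * a') (hB : ‖z‖ ^ 2 ≤ B) :
    ∃ d e : ℝ, ⟪ν, x⟫ = a' * (⟪n, z⟫ * ⟪ν, A n⟫ + d) + e ∧ d ^ 2 ≤ (1 - ⟪ν, A n⟫ ^ 2) * (B - ⟪n, z⟫ ^ 2) ∧
      |e| ≤ 1 / 16 * a' :=
  ⟨⟪ν, A z⟫ - ⟪n, z⟫ * ⟪ν, A n⟫, ⟪ν, x - a' • A z⟫, by rw [height_split ν x z a']; ring, dev_sq_le hν hn hB,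
    abs_inner_le_norm' hν hz⟩

/-- `‖z‖² ≤ 2` on a two-shell pattern. -/
theorem norm_sq_le_two {P : Finset E3} (hP : P = fccTwoShellPattern ∨ P = hcpTwoShellPattern) {z : E3} (hz : z ∈ P) :
    ‖z‖ ^ 2 ≤ 2 := by
  have h := norm_le_sqrt_two_of_mem_twoShellPattern hP hz
  have := pow_le_pow_left₀ (norm_nonneg _) h 2
  rwa [Real.sq_sqrt (by norm_num)] at this

/-! ## §3 Class-0 exclusion: in-plane sites are occupied by atoms of the same layer -/

section Exclusion

variable {aHi : ℝ} {a b ν : E3} {w : ℤ → E3}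

/-- ★★ CLASS-0 EXCLUSION.  At an atom `q` of `Y = Layered a b w` with environment frame `(a′, A)` and matched periods
`‖a − a′A p₁‖, ‖b − a′A p₂‖ ≤ a′/16`, an atom `y` matched to an IN-PLANE site `z = i p₁ + j p₂` (`|i|, |j| ≤ 1`) IS the
layer atom `q + i a + j b` — by LOCAL SEPARATION (`…CleanEnvironment.eq_of_near`) at the period atom `q + i a`. -/
theorem eq_of_inplane (hclean : ∀ q ∈ Layered a b w, IsTwoShellGoodSet (1 / 16) (9 / 10) aHi (Layered a b w) q)
    (hb0 : b ≠ 0) (hbn : ‖b‖ ≤ 17 / 16) {q : E3} (hq : q ∈ Layered a b w)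
    {a' : ℝ} {A : E3 →ₗᵢ[ℝ] E3} (ha' : 9 / 10 ≤ a')
    {p₁ p₂ : E3} (h1 : ‖a - a' • A p₁‖ ≤ 1 / 16 * a') (h2 : ‖b - a' • A p₂‖ ≤ 1 / 16 * a') (hb' : |‖b‖ - a'| ≤ 1 / 16 * a')
    {y : E3} (hy : y ∈ Layered a b w) {z : E3} (hz : ‖(y - q) - a' • A z‖ ≤ 1 / 16 * a')
    {i j : ℤ} (hi : i = -1 ∨ i = 0 ∨ i = 1) (hj : j = -1 ∨ j = 0 ∨ j = 1) (hzij : z = (i : ℝ) • p₁ + (j : ℝ) • p₂) :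
    y = q + ((i : ℝ) • a + (j : ℝ) • b) := by
  have ha'pos : 0 < a' := by linarith
  -- the distance from y to the candidate layer atom
  have hnear : ‖y - (q + ((i : ℝ) • a + (j : ℝ) • b))‖ ≤ 3 / 16 * a' := by
    have hdec : y - (q + ((i : ℝ) • a + (j : ℝ) • b)) =
        ((y - q) - a' • A z) + ((i : ℝ) • (a' • A p₁ - a) + (j : ℝ) • (a' • A p₂ - b)) := by
      rw [hzij, map_add, LinearIsometry.map_smul, LinearIsometry.map_smul, smul_add, smul_comm a' (i : ℝ),
        smul_comm a' (j : ℝ), smul_sub, smul_sub]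
      abel
    have hi1 : |(i : ℝ)| ≤ 1 := by rcases hi with rfl | rfl | rfl <;> norm_num
    have hj1 : |(j : ℝ)| ≤ 1 := by rcases hj with rfl | rfl | rfl <;> norm_num
    have hA : ‖a' • A p₁ - a‖ ≤ 1 / 16 * a' := by rw [norm_sub_rev]; exact h1
    have hB : ‖a' • A p₂ - b‖ ≤ 1 / 16 * a' := by rw [norm_sub_rev]; exact h2
    rw [hdec]
    refine (norm_add_le _ _).trans ?_
    have h3 : ‖(i : ℝ) • (a' • A p₁ - a) + (j : ℝ) • (a' • A p₂ - b)‖ ≤ 1 / 16 * a' + 1 / 16 * a' := by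
      refine (norm_add_le _ _).trans (add_le_add ?_ ?_)
      · rw [norm_smul, Real.norm_eq_abs]
        calc |(i : ℝ)| * ‖a' • A p₁ - a‖ ≤ 1 * (1 / 16 * a') := mul_le_mul hi1 hA (norm_nonneg _) (by norm_num)
          _ = 1 / 16 * a' := one_mul _
      · rw [norm_smul, Real.norm_eq_abs]
        calc |(j : ℝ)| * ‖a' • A p₂ - b‖ ≤ 1 * (1 / 16 * a') := mul_le_mul hj1 hB (norm_nonneg _) (by norm_num)
          _ = 1 / 16 * a' := one_mul _
    linarith
  -- the period atom x = q + i a and its environment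
  set x : E3 := q + (i : ℝ) • a with hx
  have hxY : x ∈ Layered a b w := by simpa [hx] using add_period_mem hq i 0
  obtain ⟨ax, hlo, -, Ax, Px, fx, hPx, hmx, -, hcx⟩ := hclean x hxY
  have haxpos : 0 < ax := by linarith
  have hxb : x + b ∈ Layered a b w := by simpa [hx, add_assoc] using add_period_mem hq i 1
  have hxb' : x - b ∈ Layered a b w := by
    have := add_period_mem hq i (-1); push_cast at this
    simpa [hx, sub_eq_add_neg, add_assoc] using this
  obtain ⟨p, hp, hp1, -, -, -, hpb⟩ := period_match hPx hmx hcx hlo hxb hxb' hb0 hbn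
  have hbx : |‖b‖ - ax| ≤ 1 / 16 * ax := by
    have := abs_norm_sub_le (ε := 1 / 16) haxpos.le hpb; rwa [hp1, mul_one] at this
  have hs1 : a' ≤ 17 / 15 * ax := scale_le_of_common_length hbx hb'
  have hcand : q + ((i : ℝ) • a + (j : ℝ) • b) = x + (j : ℝ) • b := by rw [hx]; abel
  rw [hcand] at hnear ⊢
  rcases eq_or_ne j 0 with rfl | hj0
  · -- j = 0: the candidate is x itself
    simp only [Int.cast_zero, zero_smul, add_zero] at hnear ⊢
    by_contra hyx
    have hd : dist y x ≤ 3 / 2 * ax := by rw [dist_eq_norm]; linarith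
    obtain ⟨zx, hzx, -, hzxe⟩ := exists_match hmx hcx hy hyx hd
    have hfar := le_norm_of_match hPx haxpos.le hzx hzxe
    linarith
  · -- j = ±1: local separation at x between y and x + j b
    have hjn : ‖(j : ℝ) • b‖ = ‖b‖ := by
      rw [norm_smul, Real.norm_eq_abs]
      rcases hj with rfl | rfl | rfl
      · simp
      · exact absurd rfl hj0
      · simp
    have hyb : x + (j : ℝ) • b ∈ Layered a b w := by
      have := add_period_mem hq i j; simpa [hx, add_assoc] using this
    have hbx1 : 15 / 16 * ax ≤ ‖b‖ := by have := (abs_le.1 hbx).1; linarith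
    have hbx2 : ‖b‖ ≤ 17 / 16 * ax := by have := (abs_le.1 hbx).2; linarith
    have hyx : y ≠ x := by
      intro hyx
      rw [hyx, show x - (x + (j : ℝ) • b) = -((j : ℝ) • b) by abel, norm_neg, hjn] at hnear
      linarith
    have hy'x : x + (j : ℝ) • b ≠ x := by
      intro h
      have : (j : ℝ) • b = 0 := by simpa using h
      rcases smul_eq_zero.1 this with h' | h'
      · exact hj0 (by exact_mod_cast h')
      · exact hb0 h'
    have hd'' : dist (x + (j : ℝ) • b) x = ‖b‖ := by
      rw [dist_eq_norm, show x + (j : ℝ) • b - x = (j : ℝ) • b by abel, hjn]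
    have hd' : dist (x + (j : ℝ) • b) x ≤ 3 / 2 * ax := by rw [hd'']; linarith
    have hd : dist y x ≤ 3 / 2 * ax := by
      have : dist y x ≤ ‖y - (x + (j : ℝ) • b)‖ + dist (x + (j : ℝ) • b) x := by
        rw [dist_eq_norm, dist_eq_norm]; exact norm_sub_le_norm_sub_add_norm_sub _ _ _
      rw [hd''] at this; linarith
    exact eq_of_near (ε := 1 / 16) hPx hmx hcx haxpos hy hyb hyx hy'x hd hd' (by linarith)

end Exclusion

end Summit.AtomisticToContinuum.Crystallization.Theorems.ChartedPlanarOrderStackedSiteData
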